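import Literature.LinearAlgebra.QuadraticForm.WittCancellation
import Literature.LinearAlgebra.QuadraticForm.WittEquivalence
import Literature.LinearAlgebra.QuadraticForm.MetabolicHyperbolic
import HarnessLib

/-!
# Witt equivalence of quadratic SPACES is stable isometry: `{Q₁} = {Q₂}, dim Q₁ = dim Q₂ ⇒ Q₁ ≅ Q₂`

Topic `LinearAlgebra/QuadraticForm`; namespace `Literature.LinearAlgebra.QuadraticForm`. KERNEL mathematics only
(theorems + private plumbing; no named fact, no `axiom`, no `sorry`). Closes the loop between the quotient-free
relation `WittEquivalent` of `WittEquivalence.lean` (`Q₁ ⊕ M₁ ≅ Q₂ ⊕ M₂` with `Mᵢ` having Lagrangians, possibly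
degenerate) and the classical statement for quadratic spaces [Knebusch2010, Ch. 1 §1.2]: Def. 1.8 "`φ ≈ ψ` when
`ker φ ≅ ker ψ` and `dim φ = dim ψ`", Thm 1.9 "`φ ≈ ψ` exactly when there exists a form `χ` such that
`φ ⊥ χ ≅ ψ ⊥ χ`", and "Witt's Cancellation Theorem … `φ ≈ ψ ⇒ φ ≅ ψ`" (`char K ≠ 2`); and §1.6 Def. 1.74
"`M ≅ M̂ ⊥ δ(M)`" for the passage from a degenerate witness `M` to its quadratic space `M̂`.

* §1 `equivalent_restrict_prod_zero_radical`: `Q ≅ Q|_W ⊥ 0_{rad Q}` for any complement `W` of the radical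
  (`δ(M) = rad`, Mathlib `QuadraticMap.radical`), with `Q|_W` nondegenerate (`radical_restrict_eq_bot_of_isCompl`,
  `nondegenerate_polarForm_of_radical_eq_bot`, `radical_eq_bot_of_nondegenerate`); any characteristic except
  where `2 ≠ 0` is stated.
* §2 `HasLagrangian.restrict_of_isCompl_radical`: a Lagrangian `X ⊇ rad Q` of `Q` restricts to one of `Q|_W`.
* §3 `equivalent_of_prod_zero_equivalent_prod_zero`: zero forms cancel against quadratic spaces,
  `N₁ ⊥ 0 ≅ N₂ ⊥ 0 ⇒ N₁ ≅ N₂` (`(E ⊥ M)^ = E ⊥ M̂`, [Knebusch2010, §1.6]).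
* §4 `WittEquivalent.equivalent_of_finrank_eq` (**stably isometric ⇒ isometric**): quadratic spaces `Q₁, Q₂`
  (nondegenerate polar forms) of the same dimension over a field of characteristic `≠ 2` with `Q₁ ∼ Q₂` are
  isometric; `wittEquivalent_iff_equivalent`. Ingredients: §1–§3, `IsMetabolic.equivalent_of_finrank_eq`
  (`MetabolicHyperbolic.lean`) and Witt cancellation (`WittCancellation.lean`).

## References

* [Knebusch2010] M. Knebusch, *Specialization of Quadratic and Symmetric Bilinear Forms*, Springer (2010), Ch. 1
  §1.2 (Def. 1.8, Thm 1.9, Witt's Cancellation Theorem), §1.6 (Def. 1.73–1.74).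
* [Iversen1992] B. Iversen, *Hyperbolic Geometry*, CUP (1992), Ch. I §2 — through `WittCancellation.lean`.
-/

set_option autoImplicit false

noncomputable section

open QuadraticMap Module

namespace Literature.LinearAlgebra.QuadraticForm

universe u v v₁ v₂

variable {K : Type u} [Field K]
variable {V : Type v} [AddCommGroup V] [Module K V]
variable {V₁ : Type v₁} [AddCommGroup V₁] [Module K V₁]
variable {V₂ : Type v₂} [AddCommGroup V₂] [Module K V₂]

/-! ## §1 Splitting off the radical: `Q ≅ Q|_W ⊥ 0_{rad Q}` -/

/-- **`M ≅ M̂ ⊥ δ(M)`**: for any complement `W` of the radical, `Q ≅ Q|_W ⊕ 0` through `(w, r) ↦ w + r`.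
[cite: Knebusch2010, §1.6 Def. 1.73–1.74] -/
theorem equivalent_restrict_prod_zero_radical (Q : QuadraticForm K V) {W : Submodule K V}
    (hW : IsCompl W Q.radical) :
    Q.Equivalent ((Q.restrict W).prod (0 : QuadraticForm K Q.radical)) := by
  have iso : ((Q.restrict W).prod (0 : QuadraticForm K Q.radical)).IsometryEquiv Q :=
    { toLinearEquiv := Submodule.prodEquivOfIsCompl W Q.radical hW
      map_app' := fun p => by
        change Q ((p.1 : V) + (p.2 : V)) = Q.restrict W p.1 + (0 : QuadraticForm K Q.radical) p.2
        rw [QuadraticMap.zero_apply, add_zero, add_comm, (QuadraticMap.mem_radical_iff'.1 p.2.2).2]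
        rfl }
  exact ⟨iso.symm⟩

/-- the complement `W` of the radical carries a form with trivial radical (`M̂` is a quadratic space).
[cite: Knebusch2010, §1.6 Def. 1.73–1.74] -/
theorem radical_restrict_eq_bot_of_isCompl (Q : QuadraticForm K V) {W : Submodule K V}
    (hW : IsCompl W Q.radical) : (Q.restrict W).radical = ⊥ := by
  rw [eq_bot_iff]
  intro w hw
  rw [Submodule.mem_bot]
  have hw' := QuadraticMap.mem_radical_iff'.1 hw
  have hV : (w : V) ∈ Q.radical := by
    rw [QuadraticMap.mem_radical_iff']
    refine ⟨hw'.1, fun v => ?_⟩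
    have hv : v ∈ W ⊔ Q.radical := hW.sup_eq_top ▸ Submodule.mem_top
    obtain ⟨a, ha, r, hr, rfl⟩ := Submodule.mem_sup.1 hv
    have hr' := (QuadraticMap.mem_radical_iff'.1 hr).2
    calc Q ((w : V) + (a + r)) = Q (r + ((w : V) + a)) := by congr 1; abel
      _ = Q ((w : V) + a) := hr' _
      _ = Q a := hw'.2 ⟨a, ha⟩
      _ = Q (r + a) := (hr' a).symm
      _ = Q (a + r) := by rw [add_comm]
  have e : (w : V) ∈ W ⊓ Q.radical := Submodule.mem_inf.2 ⟨w.2, hV⟩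
  rw [hW.inf_eq_bot, Submodule.mem_bot] at e
  exact Subtype.ext e

/-- trivial radical ⇒ nondegenerate polar form (characteristic `≠ 2`: `rad Q = ker` of the polar form, which is
reflexive). [cite: Knebusch2010, §1.6 Def. 1.73 ("`M` is nondegenerate iff `δ(M) = 0`")] -/
theorem nondegenerate_polarForm_of_radical_eq_bot [NeZero (2 : K)] {Q : QuadraticForm K V}
    (h : Q.radical = ⊥) : (polarForm Q).Nondegenerate := by
  haveI : Invertible (2 : K) := invertibleOfNonzero (NeZero.ne 2)
  rw [QuadraticMap.radical_eq_ker_polarBilin] at h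
  exact (polarForm_isRefl Q).nondegenerate_iff_separatingLeft.2 (LinearMap.separatingLeft_iff_ker_eq_bot.2 h)

/-- nondegenerate polar form ⇒ trivial radical (any characteristic). [cite: Knebusch2010, §1.6 Def. 1.73] -/
theorem radical_eq_bot_of_nondegenerate {Q : QuadraticForm K V} (h : (polarForm Q).Nondegenerate) :
    Q.radical = ⊥ := by
  rw [eq_bot_iff]
  intro x hx
  rw [Submodule.mem_bot]
  refine h.1 x fun y => ?_
  have e := QuadraticMap.radical_le_ker_polarBilin hx
  rw [LinearMap.mem_ker] at e
  exact LinearMap.congr_fun e y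

/-! ## §2 Lagrangians pass to the nondegenerate part -/

/-- **a Lagrangian of `Q` restricts to a Lagrangian of `Q|_W`** (`W` a complement of the radical): the radical is
orthogonal to everything, so `rad Q ⊆ X^⊥ = X` and `X = (X ∩ W) ⊕ rad Q`.
[cite: Knebusch2010, §1.6 Def. 1.74 (`M ≅ M̂ ⊥ δ(M)`); §1.2 (the class `{0}`)] -/
theorem HasLagrangian.restrict_of_isCompl_radical {Q : QuadraticForm K V} (h : HasLagrangian Q)
    {W : Submodule K V} (hW : IsCompl W Q.radical) : HasLagrangian (Q.restrict W) := by
  obtain ⟨X, hX, iso⟩ := h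
  have hpol : ∀ a b : W, polar (Q.restrict W) a b = polar Q (a : V) (b : V) := fun a b => rfl
  have hradL : ∀ r ∈ Q.radical, ∀ v : V, polar Q r v = 0 := fun r hr v => by
    have e := QuadraticMap.radical_le_ker_polarBilin hr
    rw [LinearMap.mem_ker] at e
    exact LinearMap.congr_fun e v
  have hradR : ∀ r ∈ Q.radical, ∀ v : V, polar Q v r = 0 := fun r hr v => by
    rw [polar_comm]; exact hradL r hr v
  have hRX : Q.radical ≤ X := fun r hr => by
    rw [← hX]
    exact LinearMap.BilinForm.mem_orthogonal_iff.2 fun n _ => hradR r hr n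
  refine ⟨X.comap W.subtype, ?_, fun w hw => iso _ hw⟩
  ext w
  simp only [Submodule.mem_comap, Submodule.subtype_apply, LinearMap.BilinForm.mem_orthogonal_iff,
    polarForm_apply, hpol]
  constructor
  · intro H
    rw [← hX, LinearMap.BilinForm.mem_orthogonal_iff]
    intro x hx
    have hxs : x ∈ W ⊔ Q.radical := hW.sup_eq_top ▸ Submodule.mem_top
    obtain ⟨a, ha, r, hr, rfl⟩ := Submodule.mem_sup.1 hxs
    have haX : a ∈ X := by
      have e : a = (a + r) - r := by abel
      rw [e]
      exact X.sub_mem hx (hRX hr)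
    rw [polarForm_apply, QuadraticMap.polar_add_left, hradL r hr, add_zero]
    exact H ⟨a, ha⟩ haX
  · intro H a ha
    exact iso.polar_eq_zero ha H

/-! ## §3 Zero forms cancel against quadratic spaces -/

/-- an isometry equivalence preserves polar forms. [folklore] -/
private theorem polar_isometryEquiv' {M₁ M₂ : Type*} [AddCommGroup M₁] [Module K M₁] [AddCommGroup M₂]
    [Module K M₂] {Q₁ : QuadraticForm K M₁} {Q₂ : QuadraticForm K M₂} (e : Q₁.IsometryEquiv Q₂) (x y : M₁) :
    polar Q₂ (e x) (e y) = polar Q₁ x y := by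
  simp only [polar, ← map_add, e.map_app]

/-- the polar form of a zero form vanishes. [folklore] -/
private theorem polar_zero_form {R : Type*} [AddCommGroup R] [Module K R] (x y : R) :
    polar (⇑(0 : QuadraticForm K R)) x y = 0 := by
  simp only [polar, QuadraticMap.zero_apply, sub_self]

/-- from `Q₁ ⊥ 0 ≅ Q₂ ⊥ 0` with `Q₁` nondegenerate: an injective isometric linear map `Q₁ → Q₂`
(`v ↦` first component of `f(v, 0)`). [cite: Knebusch2010, §1.6 (`(E ⊥ M)^ ≅ E ⊥ M̂`)] -/
private theorem exists_injective_isometry_of_prod_zero {R₁ R₂ : Type*} [AddCommGroup R₁] [Module K R₁]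
    [AddCommGroup R₂] [Module K R₂] {Q₁ : QuadraticForm K V₁} {Q₂ : QuadraticForm K V₂}
    (h₁ : (polarForm Q₁).Nondegenerate)
    (f : (Q₁.prod (0 : QuadraticForm K R₁)).IsometryEquiv (Q₂.prod (0 : QuadraticForm K R₂))) :
    ∃ g : V₁ →ₗ[K] V₂, Function.Injective g ∧ ∀ v, Q₂ (g v) = Q₁ v := by
  refine ⟨LinearMap.fst K V₂ R₂ ∘ₗ (f.toLinearEquiv : (V₁ × R₁) →ₗ[K] (V₂ × R₂)) ∘ₗ LinearMap.inl K V₁ R₁,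
    ?_, fun v => ?_⟩
  · refine (injective_iff_map_eq_zero _).2 fun v hv => h₁.1 v fun v' => ?_
    change (f (v, 0)).1 = 0 at hv
    have e := polar_isometryEquiv' f (v, 0) (v', 0)
    rw [QuadraticMap.polar_prod, QuadraticMap.polar_prod, hv, QuadraticMap.polar_zero_left, zero_add,
      polar_zero_form, polar_zero_form, add_zero] at e
    rw [polarForm_apply, ← e]
  · have e := f.map_app (v, 0)
    rw [QuadraticMap.prod_apply, QuadraticMap.prod_apply, QuadraticMap.zero_apply, QuadraticMap.zero_apply,
      add_zero, add_zero] at e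
    exact e

/-- **zero forms cancel against quadratic spaces**: `Q₁ ⊥ 0 ≅ Q₂ ⊥ 0` with `Q₁, Q₂` nondegenerate (finite
dimension, any numbers of zeros) ⇒ `Q₁ ≅ Q₂` — the associated quadratic spaces of isometric modules are isometric.
[cite: Knebusch2010, §1.6 Def. 1.74 and the display `(E ⊥ M)^ ≅ E ⊥ M̂`] -/
theorem equivalent_of_prod_zero_equivalent_prod_zero [FiniteDimensional K V₁] [FiniteDimensional K V₂]
    {R₁ R₂ : Type*} [AddCommGroup R₁] [Module K R₁] [AddCommGroup R₂] [Module K R₂]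
    {Q₁ : QuadraticForm K V₁} {Q₂ : QuadraticForm K V₂} (h₁ : (polarForm Q₁).Nondegenerate)
    (h₂ : (polarForm Q₂).Nondegenerate)
    (h : (Q₁.prod (0 : QuadraticForm K R₁)).Equivalent (Q₂.prod (0 : QuadraticForm K R₂))) :
    Q₁.Equivalent Q₂ := by
  obtain ⟨f⟩ := h
  obtain ⟨g, hg, hgQ⟩ := exists_injective_isometry_of_prod_zero h₁ f
  obtain ⟨g', hg', -⟩ := exists_injective_isometry_of_prod_zero h₂ f.symm
  have hdim : finrank K V₁ = finrank K V₂ :=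
    le_antisymm (LinearMap.finrank_le_finrank_of_injective hg) (LinearMap.finrank_le_finrank_of_injective hg')
  have hsurj : Function.Surjective g := (LinearMap.injective_iff_surjective_of_finrank_eq_finrank hdim).1 hg
  exact ⟨{ toLinearEquiv := LinearEquiv.ofBijective g ⟨hg, hsurj⟩, map_app' := fun v => hgQ v }⟩

/-! ## §4 Stably isometric quadratic spaces are isometric -/

/-- reassociation `(Q₁ ⊕ Q₂) ⊕ Q₃ ≅ Q₁ ⊕ (Q₂ ⊕ Q₃)` (plumbing). [folklore] -/
private def prodAssocEquiv'' {M₁ M₂ M₃ : Type*} [AddCommGroup M₁] [Module K M₁] [AddCommGroup M₂]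
    [Module K M₂] [AddCommGroup M₃] [Module K M₃] (Q₁ : QuadraticForm K M₁) (Q₂ : QuadraticForm K M₂)
    (Q₃ : QuadraticForm K M₃) : ((Q₁.prod Q₂).prod Q₃).IsometryEquiv (Q₁.prod (Q₂.prod Q₃)) where
  toLinearEquiv := LinearEquiv.prodAssoc K M₁ M₂ M₃
  map_app' x := by
    obtain ⟨⟨a, b⟩, c⟩ := x
    simp only [QuadraticMap.prod_apply]
    change Q₁ a + (Q₂ b + Q₃ c) = Q₁ a + Q₂ b + Q₃ c
    rw [add_assoc]

/-- **stably isometric quadratic spaces are isometric** [Knebusch2010, §1.2]: over a field of characteristic `≠ 2`,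
two quadratic forms `Q₁, Q₂` with nondegenerate polar forms on spaces of the same (finite) dimension which are
Witt equivalent (`Q₁ ⊕ M₁ ≅ Q₂ ⊕ M₂`, `Mᵢ` with Lagrangians) are isometric. Proof: `Mᵢ ≅ M̂ᵢ ⊥ 0` (§1) with
`M̂ᵢ` metabolic (§2); zeros cancel (§3): `Q₁ ⊕ M̂₁ ≅ Q₂ ⊕ M̂₂`; dimensions force `dim M̂₁ = dim M̂₂`, so
`M̂₁ ≅ M̂₂` (metabolic = hyperbolic); Witt cancellation. [cite: Knebusch2010, Ch. 1 §1.2 (Def. 1.8, Thm 1.9, Witt's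
Cancellation Theorem); §1.6 Def. 1.74] -/
theorem WittEquivalent.equivalent_of_finrank_eq [NeZero (2 : K)] [FiniteDimensional K V₁]
    [FiniteDimensional K V₂] {Q₁ : QuadraticForm K V₁} {Q₂ : QuadraticForm K V₂}
    (h : WittEquivalent Q₁ Q₂) (hQ₁ : (polarForm Q₁).Nondegenerate) (hQ₂ : (polarForm Q₂).Nondegenerate)
    (hd : finrank K V₁ = finrank K V₂) : Q₁.Equivalent Q₂ := by
  obtain ⟨m₁, m₂, M₁, M₂, hM₁, hM₂, e⟩ := h
  -- the quadratic spaces `M̂ᵢ = Mᵢ|_{Wᵢ}`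
  obtain ⟨W₁, hW₁⟩ := M₁.radical.exists_isCompl
  obtain ⟨W₂, hW₂⟩ := M₂.radical.exists_isCompl
  have s₁ := equivalent_restrict_prod_zero_radical M₁ hW₁.symm
  have s₂ := equivalent_restrict_prod_zero_radical M₂ hW₂.symm
  have n₁ : (polarForm (M₁.restrict W₁)).Nondegenerate :=
    nondegenerate_polarForm_of_radical_eq_bot (radical_restrict_eq_bot_of_isCompl M₁ hW₁.symm)
  have n₂ : (polarForm (M₂.restrict W₂)).Nondegenerate :=
    nondegenerate_polarForm_of_radical_eq_bot (radical_restrict_eq_bot_of_isCompl M₂ hW₂.symm)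
  have l₁ : IsMetabolic (M₁.restrict W₁) := (hM₁.restrict_of_isCompl_radical hW₁.symm).isMetabolic n₁
  have l₂ : IsMetabolic (M₂.restrict W₂) := (hM₂.restrict_of_isCompl_radical hW₂.symm).isMetabolic n₂
  -- `(Q₁ ⊕ M̂₁) ⊕ 0 ≅ (Q₂ ⊕ M̂₂) ⊕ 0`
  have e' : ((Q₁.prod (M₁.restrict W₁)).prod (0 : QuadraticForm K M₁.radical)).Equivalent
      ((Q₂.prod (M₂.restrict W₂)).prod (0 : QuadraticForm K M₂.radical)) :=
    (QuadraticMap.Equivalent.trans ⟨prodAssocEquiv'' Q₁ (M₁.restrict W₁) 0⟩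
      (((QuadraticMap.Equivalent.refl Q₁).prod s₁.symm).trans e)).trans
      (((QuadraticMap.Equivalent.refl Q₂).prod s₂).trans ⟨(prodAssocEquiv'' Q₂ (M₂.restrict W₂) 0).symm⟩)
  -- zeros cancel
  have N₁ : (polarForm (Q₁.prod (M₁.restrict W₁))).Nondegenerate := nondegenerate_polarForm_prod hQ₁ n₁
  have N₂ : (polarForm (Q₂.prod (M₂.restrict W₂))).Nondegenerate := nondegenerate_polarForm_prod hQ₂ n₂
  have e'' := equivalent_of_prod_zero_equivalent_prod_zero N₁ N₂ e'
  -- dimensions: `dim M̂₁ = dim M̂₂`, so `M̂₁ ≅ M̂₂`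
  have hW : finrank K W₁ = finrank K W₂ := by
    obtain ⟨g⟩ := e''
    have e₁ := g.toLinearEquiv.finrank_eq
    rw [Module.finrank_prod, Module.finrank_prod] at e₁
    omega
  have mm : (M₁.restrict W₁).Equivalent (M₂.restrict W₂) := l₁.equivalent_of_finrank_eq l₂ hW
  -- `Q₁ ⊕ M̂₁ ≅ Q₂ ⊕ M̂₁`, then Witt cancellation
  have e₃ : (Q₁.prod (M₁.restrict W₁)).Equivalent (Q₂.prod (M₁.restrict W₁)) :=
    e''.trans ((QuadraticMap.Equivalent.refl Q₂).prod mm.symm)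
  exact equivalent_of_prod_equivalent_prod_right n₁ hQ₂ e₃

/-- **for quadratic spaces of equal dimension, Witt equivalence is isometry** (characteristic `≠ 2`):
`Q₁ ∼ Q₂ ↔ Q₁ ≅ Q₂`. [cite: Knebusch2010, Ch. 1 §1.2 (Def. 1.8, Thm 1.9, Witt's Cancellation Theorem)] -/
theorem wittEquivalent_iff_equivalent [NeZero (2 : K)] [FiniteDimensional K V₁] [FiniteDimensional K V₂]
    {Q₁ : QuadraticForm K V₁} {Q₂ : QuadraticForm K V₂} (hQ₁ : (polarForm Q₁).Nondegenerate)
    (hQ₂ : (polarForm Q₂).Nondegenerate) (hd : finrank K V₁ = finrank K V₂) :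
    WittEquivalent Q₁ Q₂ ↔ Q₁.Equivalent Q₂ :=
  ⟨fun h => h.equivalent_of_finrank_eq hQ₁ hQ₂ hd, WittEquivalent.of_equivalent⟩

end Literature.LinearAlgebra.QuadraticForm
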